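import Summits.BirchSwinnertonDyer.Rank1Residual.X2.CyclotomicDecompositionCount
import Literature.NumberTheory.EllipticCurves.Greenberg1999.ControlLocalKernelsLayerGoodInputsProofs
import Literature.NumberTheory.EllipticCurves.CyclotomicZpExtensionLayerProofs
import Literature.NumberTheory.EllipticCurves.CyclotomicZpExtensionLayerTwoProofs
import Literature.NumberTheory.EllipticCurves.IwasawaSelmerControlLocalInputsProofs
import Literature.NumberTheory.EllipticCurves.IwasawaSelmerControlLocalizationProofs
import HarnessLib

/-!
# H46 kernel programme (road C′), brick R4 of `NOTE-B6-SCHEDULE-GEN38` §4: an auxiliary good place `v₀ ∉ S` that SPLITS COMPLETELY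
# in the layer `ℚ_n` of the cyclotomic `ℤ_p`-extension — `ℓ ≡ 1 (mod p^{n+2})` ⟹ `D_ℓ ≤ Gal(ℚ̄/ℚ_n)`

Cell `bsd-2adic` (run/shared/lean/pub/bsd-2adic/), seat `bsd-2adic-tower-1` GEN 39; `--supports stmt-BirchSwinnertonDyer-19271`
(helper, item `OrdKatoHalfAtTwo`, TOWER road). THEOREMS ONLY (no definition, no named fact, no instance, no `sorry`); closes no item;
nothing booked; BSD is not proved by any of this.

The B6 schedule (`…TorsionEulerCharB6Schedule.exists_layer_cores_reduce_eq_zero`) fixes a deep layer `n*` FIRST; the auxiliary place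
`v₀` of Greenberg's Lemma 4.6 is then chosen split in `ℚ_{n*}`, so that the local subgroup of `Γ_{n*}` at `v₀` is the whole local Galois
group `Γ_{ℚ_{v₀}}` and the layer-`0` exponent argument of GEN 35 (`H46LevelZero.pow_nsmul_localH1_layerZero_eq_zero`) applies
verbatim at the layer `n*`.

* §1 `mem_localSubgroup_layerSubgroup_of_norm_sub_one_le` — for the CYCLOTOMIC `κ` of `ℚ` (any `p`): an element `τ ∈ Γ_{ℚ_v}` whose
  `p`-adic cyclotomic character satisfies `‖χ_p(τ|_{ℚ̄}) − 1‖ ≤ ‖p^{n+2}‖` lies in the local subgroup of the layer `n`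
  (`κ = u · ℓog ∘ χ_p`, `IsCyclotomic.exists_eq_unitTwist_holds`; `pow_dvd_ell_of_norm_sub_one_le(_two)`).
* §2 **`localSubgroup_layerSubgroup_eq_top_of_pow_dvd`** — for a finite place `v ∤ p` of `ℚ` with residue characteristic
  `ℓ ≡ 1 (mod p^{n+2})`: `localSubgroup (κ.layerSubgroup n) ℚ_v = ⊤`, i.e. `D_v ≤ Gal(ℚ̄/ℚ_n)`, `v` splits completely in `ℚ_n`
  (`χ_p(Frob_v) = ℓ`, X2 `cyclotomicCharacter_absGaloisRestrict_of_isAbsArithFrob`; `Γ_{ℚ_v}` is generated by Frobenius and inertia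
  modulo open subgroups, `Greenberg1999.exists_frobenius_pow_generate_localSubgroup`; inertia at `v ∤ p` lies in `Gal(ℚ̄/ℚ_∞)`).
* §3 **`exists_not_mem_localSubgroup_layerSubgroup_eq_top`** — Dirichlet (`Nat.exists_prime_gt_modEq_one`): for every finite `S` and
  every `n` there is a place `v₀ ∉ S` of `ℚ` with `localSubgroup (κ.layerSubgroup n) ℚ_{v₀} = ⊤`; with the cell's standing `hS`
  (`p ∉ v` and good reduction off `S`) such a `v₀` is good and prime to `p`.

References: [Washington1997] §13.1 (`ℚ_n ⊂ ℚ(μ_{p^{n+1}})`, resp. `ℚ(μ_{2^{n+2}})`); [NeukirchANT1999] Ch. II §9 (9.9)–(9.11);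
[SerreAbelianLadic1968] Ch. I §1.2 (`χ_ℓ(Frob_v) = N v`); [GreenbergLNM1716] §4 Lemma 4.6 (p. 105: «choose a prime `v₀`…»).
-/

set_option autoImplicit false
-- the Theorems namespace of this sub repeats the summit name by design (D-0017 nested layout)
set_option linter.dupNamespace false

noncomputable section

open scoped Classical NumberField

namespace Summit.BirchSwinnertonDyer.BirchSwinnertonDyer.Theorems

namespace TorsionEulerChar.H46SplitAuxPrime

open Field NumberField IsDedekindDomain
  Literature.NumberTheory.EllipticCurves Literature.NumberTheory.EllipticCurves.CyclotomicZp
  Literature.NumberTheory.GaloisRepresentations ZpExtension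
open Summit.BirchSwinnertonDyer.Rank1Residual.X2.CyclotomicDecompositionCount
  (cyclotomicCharacter_absGaloisRestrict_of_isAbsArithFrob isArithFrobAt_of_isFrobPow_one)

variable {p : ℕ} [hp : Fact p.Prime] (κ : ZpExtension ℚ p)

/-! ## §1 The cyclotomic reading: `‖χ_p(τ) − 1‖ ≤ ‖p^{n+2}‖ ⟹ τ ∈ Gal(ℚ̄/ℚ_n)` locally -/

/-- **`‖χ_p(τ|_{ℚ̄}) − 1‖ ≤ ‖p^{n+2}‖ ⟹ τ ∈ localSubgroup (κ.layerSubgroup n)`** for the cyclotomic `ℤ_p`-extension `κ` of `ℚ` (any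
prime `p`): `κ = u · ℓog ∘ χ_p` for a unit `u` (uniqueness of the cyclotomic `ℤ_p`-extension up to `ℤ_pˣ`), and `p^n ∣ ℓog(x)` as soon as
`‖x − 1‖ ≤ ‖p^{n+1}‖` (`p` odd) resp. `≤ ‖2^{n+2}‖` (`p = 2`). [cite: Washington1997, §13.1] -/
theorem mem_localSubgroup_layerSubgroup_of_norm_sub_one_le (hκ : κ.IsCyclotomic) (n : ℕ) {E : Type} [Field E] [Algebra ℚ E]
    (τ : absoluteGaloisGroup E)
    (hτ : ‖((GaloisRep.cyclotomicCharacter ℚ p (resGal (K := ℚ) E τ) : ℤ_[p]ˣ) : ℤ_[p]) - 1‖ ≤ ‖(p : ℤ_[p]) ^ (n + 2)‖) :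
    τ ∈ localSubgroup (κ.layerSubgroup n) E := by
  obtain ⟨u, rfl⟩ := ZpExtension.IsCyclotomic.exists_eq_unitTwist_holds (isCyclotomic_zpExtension p) hκ
  rw [mem_localSubgroup_iff, layerSubgroup_unitTwist, ZpExtension.mem_layerSubgroup, zpExtension_apply, toAdd_ofAdd]
  by_cases hp2 : p = 2
  · subst hp2
    exact pow_dvd_ell_of_norm_sub_one_le_two _ n hτ
  · refine pow_dvd_ell_of_norm_sub_one_le p hp2 _ n (hτ.trans ?_)
    exact PadicOneUnits.norm_le_of_dvd (pow_dvd_pow _ (Nat.le_succ _))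

/-! ## §2 `ℓ ≡ 1 (mod p^{n+2})` ⟹ `v_ℓ` splits completely in `ℚ_n` -/

/-- **`D_v ≤ Gal(ℚ̄/ℚ_n)` for `ℓ_v ≡ 1 (mod p^{n+2})`, `v ∤ p`.** For the cyclotomic `ℤ_p`-extension `κ` of `ℚ` and a finite place `v ∤ p`
whose residue characteristic `ℓ = natGenerator v` satisfies `p^{n+2} ∣ ℓ − 1`, the local subgroup of the layer `n` at `ℚ_v` is ALL of
`Γ_{ℚ_v}`: `v` splits completely in `ℚ_n`. Proof: an absolute arithmetic Frobenius `τ` has `χ_p(τ|_{ℚ̄}) = ℓ`, hence lies in the (open) local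
subgroup of the layer by §1; that subgroup contains the inertia group (a `ℤ_p`-extension is unramified at `v ∤ p`), and `Γ_{ℚ_v}` is generated
by `τ` and inertia modulo every open subgroup. [cite: Washington1997, §13.1] [cite: NeukirchANT1999, Ch. II §9 Prop. (9.9)–(9.11)]
[cite: SerreAbelianLadic1968, Ch. I §1.2] -/
theorem localSubgroup_layerSubgroup_eq_top_of_pow_dvd (hκ : κ.IsCyclotomic) (n : ℕ) {v : HeightOneSpectrum (𝓞 ℚ)}
    (hpv : ((p : ℕ) : 𝓞 ℚ) ∉ v.asIdeal) (hℓ : p ^ (n + 2) ∣ Rat.HeightOneSpectrum.natGenerator v - 1) :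
    localSubgroup (κ.layerSubgroup n) (v.adicCompletion ℚ) = ⊤ := by
  obtain ⟨𝔐, h𝔐⟩ := v.localPrimesAbove_nonempty
  obtain ⟨τ, hτ⟩ := exists_isAbsArithFrob_holds (F := v.adicCompletion ℚ)
  have hF : IsArithFrobAt (v.adicCompletionIntegers ℚ) τ 𝔐 := isArithFrobAt_of_isFrobPow_one (IsAbsArithFrob.isFrobPow_holds hτ) h𝔐
  -- `τ` lies in the local subgroup of the layer `n`
  have hτn : τ ∈ localSubgroup (κ.layerSubgroup n) (v.adicCompletion ℚ) := by
    refine mem_localSubgroup_layerSubgroup_of_norm_sub_one_le κ hκ n τ ?_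
    change ‖((GaloisRep.cyclotomicCharacter ℚ p (absGaloisRestrict ℚ (v.adicCompletion ℚ) τ) : ℤ_[p]ˣ) : ℤ_[p]) - 1‖ ≤ _
    rw [cyclotomicCharacter_absGaloisRestrict_of_isAbsArithFrob hpv hτ]
    have h1 : 1 ≤ Rat.HeightOneSpectrum.natGenerator v := (Rat.HeightOneSpectrum.prime_natGenerator v).one_lt.le
    obtain ⟨c, hc⟩ := hℓ
    have e : (Rat.HeightOneSpectrum.natGenerator v : ℤ_[p]) - 1 = (p : ℤ_[p]) ^ (n + 2) * c := by
      rw [← Nat.cast_pow, ← Nat.cast_mul, ← hc, Nat.cast_sub h1, Nat.cast_one]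
    rw [e]
    exact PadicOneUnits.norm_le_of_dvd (dvd_mul_right _ _)
  -- Frobenius + inertia generate `Γ_{ℚ_v}` modulo the open subgroup `localSubgroup (κ.layerSubgroup n)`
  obtain ⟨M, -, -, hgen⟩ := Greenberg1999.exists_frobenius_pow_generate_localSubgroup κ hpv h𝔐 hF 0
  have hI : 𝔐.inertia (absoluteGaloisGroup (v.adicCompletion ℚ)) ≤ localSubgroup (κ.layerSubgroup n) (v.adicCompletion ℚ) :=
    fun σ hσ ↦ WeierstrassCurve.localSubgroup_ker_le_layer κ (v.adicCompletion ℚ) n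
      ((mem_localSubgroup_iff _ _ σ).mpr (ZpExtension.inertia_le_kerSubgroup_holds ℚ p κ hpv (IsDedekindDomain.HeightOneSpectrum.primeBelow_mem_primesAbove h𝔐)
        (v.resGalOfEmb_mem_inertia_primeBelow (closureEmb (K := ℚ) (v.adicCompletion ℚ)) 𝔐 hσ)))
  have hle := hgen _ (isOpen_localSubgroup_layerSubgroup (v.adicCompletion ℚ) κ n) hI (pow_mem hτn M)
  refine eq_top_iff.mpr fun σ _ ↦ hle ?_
  rw [mem_localSubgroup_iff, ZpExtension.layerSubgroup_zero]
  exact Subgroup.mem_top _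

/-! ## §3 Dirichlet: a split auxiliary place outside any finite set -/

/-- **There is a place `v₀ ∉ S` of `ℚ` that splits completely in `ℚ_n`** (`localSubgroup (κ.layerSubgroup n) ℚ_{v₀} = ⊤`), for every finite
set `S` of places containing the place of `p`: take a prime `ℓ ≡ 1 (mod p^{n+2})` larger than every residue characteristic of `S`
(Dirichlet, `Nat.exists_prime_gt_modEq_one`). [cite: Washington1997, §13.1] [cite: GreenbergLNM1716, §4 Lemma 4.6 (p. 105)] -/
theorem exists_not_mem_localSubgroup_layerSubgroup_eq_top (hκ : κ.IsCyclotomic) (n : ℕ) (S : Finset (HeightOneSpectrum (𝓞 ℚ)))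
    (hS : ∀ v : HeightOneSpectrum (𝓞 ℚ), v ∉ S → ((p : ℕ) : 𝓞 ℚ) ∉ v.asIdeal) :
    ∃ v₀ : HeightOneSpectrum (𝓞 ℚ), v₀ ∉ S ∧ localSubgroup (κ.layerSubgroup n) (v₀.adicCompletion ℚ) = ⊤ := by
  obtain ⟨q, hq, hlt, hmod⟩ := Nat.exists_prime_gt_modEq_one (S.sup Rat.HeightOneSpectrum.natGenerator) (pow_ne_zero (n + 2) hp.out.ne_zero)
  set v₀ : HeightOneSpectrum (𝓞 ℚ) := (Rat.HeightOneSpectrum.primesEquiv (R := 𝓞 ℚ)).symm ⟨q, hq⟩ with hv₀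
  have hgen : Rat.HeightOneSpectrum.natGenerator v₀ = q :=
    congrArg Subtype.val ((Rat.HeightOneSpectrum.primesEquiv (R := 𝓞 ℚ)).apply_symm_apply ⟨q, hq⟩)
  have hv₀S : v₀ ∉ S := fun h ↦ by
    have hle : Rat.HeightOneSpectrum.natGenerator v₀ ≤ S.sup Rat.HeightOneSpectrum.natGenerator := Finset.le_sup h
    rw [hgen] at hle
    exact absurd hlt (not_lt.mpr hle)
  refine ⟨v₀, hv₀S, localSubgroup_layerSubgroup_eq_top_of_pow_dvd κ hκ n (hS v₀ hv₀S) ?_⟩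
  rw [hgen]
  exact (Nat.modEq_iff_dvd' hq.one_lt.le).mp hmod.symm

end TorsionEulerChar.H46SplitAuxPrime

end Summit.BirchSwinnertonDyer.BirchSwinnertonDyer.Theorems

end
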